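import Mathlib
import HarnessLib
import Literature.AlgebraicGeometry.Resolution.InseparableLocalUniformization
import Literature.AlgebraicGeometry.Resolution.ArithmeticalThreefoldsLocalChart
import Summits.ResolutionOfSingularities.ResolutionOfSingularities.Theorems.HomologicalConductorNoZenoOrdValuationChart
import Summits.ResolutionOfSingularities.ResolutionOfSingularities.Theorems.SyzygyFlatteningHigherRankTerminationLocAt
import Summits.ResolutionOfSingularities.ResolutionOfSingularities.Theorems.RuledResiduesRegularModelRuledReach
import Summits.ResolutionOfSingularities.ResolutionOfSingularities.Theorems.FrobeniusClosingSteerQuadraticStepLemmas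

/-!
# Route `HomologicalConductor`, crux `NoZeno`/`NoZenoR` (stmt-ResolutionOfSingularities-16483 / -19943),
# line `sandwich-cluster`: an essentially finite prime divisor of `R` IS the order valuation `E_q`
# of an infinitely near point `q` (Zariski)

OURS (cell res-hironaka, crux chain W4.4, seat res-L0-w44-stub-3). Nothing here is a statement of the
manuscript under review (Hironaka 2017); AI-written, weaker than expert review.

Fourth companion of `HomologicalConductorNoZenoOrdValuation.lean`.  The bridge «exceptional prime
divisor ⇒ base point» that the provers of S2 (`stub_regularOfBasePtsEmpty`) and of the `≠` half of
S4 (`stub_basePtsStrictAnti`) need (CRUX-PLAN W4.4 v2 §2: «Rees valuations of `ca` are `E_q`'s»,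
«essential divisors of a sandwiched point are `E_q`'s»):

* (imported: `SwitchingDichotomy.QuadraticStep.exists_eq_div_pow_of_mem_blowupRing` — every element
  of the chart `R[𝔪_R/x]` is `a/x^m` with `a ∈ 𝔪_R^m`);
* `blowupRing_le_of_coe_eq_ordSet` — the chart `S[𝔪_S/x]` lies in `E_S` (`x ∈ 𝔪_S ∖ 𝔪_S²`);
* `mem_pow_succ_of_valuation_div_pow_lt_one` — **centre transfer**: if a DVR `W` of `K`, in which
  `x` has positive value, contains `B = S[𝔪_S/x]` and equals `B` localised at its centre
  (`locAtCentre`), then the centre of `W` on `B` lies in the exceptional prime: for `a ∈ 𝔪_Sⁿ`,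
  `v_W(a/xⁿ) < 1 ⇒ a ∈ 𝔪_Sⁿ⁺¹`.  (Were `z = a/xⁿ` of exact order `n` with `v_W(z) < 1`, some
  `t = x^α/z^β` is a unit of the DVR `W`, `t = b/c` with `b, c ∈ B`, `v_W(c) = 1`; but
  `v_{E_S}(t) = v_{E_S}(x)^α < 1` gives `v_{E_S}(b) < 1`, so `b ∈ x·B` and `v_W(t) = v_W(b) < 1`.)
  No residue-field computation (`chartQuotient`) is needed: `E_S` replaces it.
* **`exists_coe_eq_ordSet_of_isDiscreteValuationRing`** — ZARISKI: `R` regular local of dimension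
  two, `Frac R = K`, `tr.deg_k K = 2`; `W` a DVR of `K` dominating `R` and essentially of finite type
  over it (`W = N_{𝔪_W ∩ N}`, `N` finitely generated over `R` — the hypothesis shape of the tree's
  `RuledResidues….dvrReach`) ⇒ `∃ S : Subalgebra k K`, `R ≤ S`, `S` regular local of dimension two,
  dominated by `W`, with `↑W = ordSet S`.  Proof: the quadratic sequence of `R` along `W` reaches
  `W` (`dvrReach`) and the member before is regular of dimension `≥ 2` with transform `W`
  (`penultimate`); it is a `k`-subalgebra of dimension `≤ tr.deg = 2`
  (`ringKrullDim_le_of_trdeg_le`); its transform being `W` gives the chart conditions of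
  `coe_eq_ordSet_of_chart_le` through the centre transfer.

Not here: the same for prime divisors that are NOT essentially of finite type over `R` (then the
sequence need not reach `W` in finitely many steps unless `W` is residually transcendental — Zariski;
not needed: the `W` of the line are local rings of normalised blow-ups, essentially of finite type).

References: O. Zariski, P. Samuel, *Commutative Algebra* II (1960), App. 5 [`ZariskiSamuel1960`];
S. Abhyankar, Amer. J. Math. 78 (1956), Prop. 3, Thm. 3 [`Abhyankar1956Valuations`].
-/

noncomputable section

-- single-problem summit: the doubled namespace component `ResolutionOfSingularities` is forced
set_option linter.dupNamespace false

namespace Summit.ResolutionOfSingularities.ResolutionOfSingularities.Theorems.NoZeno.SandwichCluster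

open IsLocalRing Literature.AlgebraicGeometry.Resolution
open Summit.ResolutionOfSingularities.ResolutionOfSingularities.Theorems

variable {k K : Type} [Field k] [Field K] [Algebra k K]

/-! ## The centre of a DVR on the chart of a regular `S`: transfer from `E_S` -/

section CentreTransfer

variable {S : Subalgebra k K} [IsRegularLocalRing ↥S]

/-- The chart `S[𝔪_S/x]` lies in the order valuation ring (`x ∈ 𝔪_S ∖ 𝔪_S²`). [folklore] -/
theorem blowupRing_le_of_coe_eq_ordSet (V : ValuationSubring K) (hV : (V : Set K) = ordSet S)
    {x : ↥S} (hx : x ∈ maximalIdeal ↥S) (hx2 : x ∉ maximalIdeal ↥S ^ 2) :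
    blowupRing S.toSubring (x : K) ≤ V.toSubring := by
  have h := chart_conditions_of_coe_eq_ordSet V hV hx hx2
  refine Subring.closure_le.mpr ?_
  rintro z (hz | ⟨y, hy, rfl⟩)
  · exact le_toSubring_of_coe_eq_ordSet V hV hz
  · exact h.1 y hy

/-- **Centre transfer.**  Let `W` be a discrete valuation ring of `K` in which `x` has positive
value, containing the chart `B = S[𝔪_S/x]` (`x ∈ 𝔪_S ∖ 𝔪_S²`) and equal to the localisation of `B`
at its centre.  Then the centre of `W` on `B` lies in the exceptional prime: for `a ∈ 𝔪_Sⁿ`,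
`v_W(a/xⁿ) < 1 ⇒ a ∈ 𝔪_Sⁿ⁺¹`.  (If `z = a/xⁿ` had `v_W(z) < 1` but order exactly `n`, then in the
DVR `W` some `t = x^α / z^β` is a unit; but `t = b/c` with `b, c ∈ B`, `v_W(c) = 1`, and
`v_{E_S}(t) = v_{E_S}(x)^α < 1` forces `v_{E_S}(b) < 1`, i.e. `b ∈ x·B`, so `v_W(b) < 1 = v_W(t)`.)
[cite: ZariskiSamuel1960, App. 5] -/
theorem mem_pow_succ_of_valuation_div_pow_lt_one [IsFractionRing ↥S K] (W : ValuationSubring K)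
    [IsDiscreteValuationRing ↥W] {x : ↥S} (hx : x ∈ maximalIdeal ↥S)
    (hx2 : x ∉ maximalIdeal ↥S ^ 2) (hxW : W.valuation (x : K) < 1)
    (hBW : blowupRing S.toSubring (x : K) ≤ W.toSubring)
    (hWB : W.toSubring ≤ locAtCentre (blowupRing S.toSubring (x : K)) W) :
    ∀ (n : ℕ) (a : ↥S), a ∈ maximalIdeal ↥S ^ n →
      W.valuation ((a : K) / (x : K) ^ n) < 1 → a ∈ maximalIdeal ↥S ^ (n + 1) := by
  haveI := isDomain_of_isRegularLocalRing (↥S)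
  obtain ⟨V, hV⟩ := exists_valuationSubring_coe_eq_ordSet S
  have hBV := blowupRing_le_of_coe_eq_ordSet V hV hx hx2
  have hx0 : x ≠ 0 := by rintro rfl; exact hx2 (zero_mem _)
  have hxK : (x : K) ≠ 0 := fun h => hx0 (by exact_mod_cast h)
  have hxS : x ∈ maximalIdeal ↥S.toSubring := hx
  intro n a ha hwz
  by_contra ha'
  -- `z = a/xⁿ`, of `E_S`-value one, `W`-value `< 1`
  set z : K := (a : K) / (x : K) ^ n with hz
  have ha0 : a ≠ 0 := by rintro rfl; exact ha' (zero_mem _)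
  have haK : (a : K) ≠ 0 := fun h => ha0 (by exact_mod_cast h)
  have hz0 : z ≠ 0 := div_ne_zero haK (pow_ne_zero _ hxK)
  have hzB : z ∈ blowupRing S.toSubring (x : K) := div_pow_mem_blowupRing (x : K) n (f := ⟨a, a.2⟩) ha
  have hzW : z ∈ W := hBW hzB
  have hzV : z ∈ V := hBV hzB
  have hvz : V.valuation z = 1 := by
    rcases ((ValuationSubring.valuation_le_one_iff V z).mpr hzV).lt_or_eq with hlt | heq
    · exact absurd ((valuation_div_pow_lt_one_iff V hV hx hx2 ha).mp hlt) ha'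
    · exact heq
  have hvx : V.valuation (x : K) < 1 := (valuation_coe_lt_one_iff V hV x).mpr hx
  -- in the DVR `W`: `z ~ ϖ^α` with `α ≥ 1`, `x ~ ϖ^β`
  obtain ⟨ϖ, hϖ⟩ := IsDiscreteValuationRing.exists_irreducible ↥W
  set zW : ↥W := ⟨z, hzW⟩ with hzWdef
  set xW : ↥W := ⟨(x : K), hBW (le_blowupRing _ _ x.2)⟩ with hxWdef
  have hzW0 : zW ≠ 0 := fun h => hz0 (congrArg Subtype.val h)
  have hxW0 : xW ≠ 0 := fun h => hxK (congrArg Subtype.val h)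
  obtain ⟨α, hα⟩ := IsDiscreteValuationRing.associated_pow_irreducible hzW0 hϖ
  obtain ⟨β, hβ⟩ := IsDiscreteValuationRing.associated_pow_irreducible hxW0 hϖ
  have hα1 : α ≠ 0 := by
    rintro rfl
    rw [pow_zero, associated_one_iff_isUnit, ValuationSubring.valuation_eq_one_iff] at hα
    exact absurd hα hwz.ne
  -- `x^α / z^β` is a unit of `W`
  have hassoc : Associated (xW ^ α) (zW ^ β) := by
    have h1 : Associated (xW ^ α) ((ϖ ^ β) ^ α) := hβ.pow_pow
    have h2 : Associated (zW ^ β) ((ϖ ^ α) ^ β) := hα.pow_pow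
    rw [← pow_mul, mul_comm, pow_mul] at h1
    exact h1.trans h2.symm
  obtain ⟨u, hu⟩ := hassoc
  have huK : (x : K) ^ α * ((u : ↥W) : K) = z ^ β := by
    have := congrArg Subtype.val hu
    simpa [hxWdef, hzWdef] using this
  set t : K := (x : K) ^ α / z ^ β with ht
  have hxα0 : (x : K) ^ α ≠ 0 := pow_ne_zero _ hxK
  have ht0 : t ≠ 0 := div_ne_zero hxα0 (pow_ne_zero _ hz0)
  have hprod : ((↑u⁻¹ : ↥W) : K) * ((u : ↥W) : K) = 1 := by
    rw [← Subring.coe_mul, Units.inv_mul]; rfl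
  have htu : t = (((u : ↥W) : K))⁻¹ := by
    rw [ht, ← huK, ← div_div, div_self hxα0, one_div]
  have htW : t ∈ W := by
    rw [htu, ← eq_inv_of_mul_eq_one_left hprod]
    exact (↑u⁻¹ : ↥W).2
  have htinvW : t⁻¹ ∈ W := by
    rw [htu, inv_inv]
    exact (u : ↥W).2
  have hwt : W.valuation t = 1 := SyzygyFlattening.valuation_eq_one_of_inv_mem W htW htinvW ht0
  -- `t = b / c` with `b, c ∈ B`, `v_W(c) = 1`
  obtain ⟨b, hb, c, hc, hwc, htbc⟩ := (mem_locAtCentre_iff).mp (hWB htW)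
  have hc0 : c ≠ 0 := ne_zero_of_valuation_eq_one hwc
  -- `E_S`-values: `v(t) = v(x)^α < 1`, hence `v(b) < 1`
  have hvt : V.valuation t < 1 := by
    rw [ht, map_div₀, map_pow, map_pow, hvz, one_pow, div_one]
    exact pow_lt_one₀ zero_le hvx hα1
  have hvb : V.valuation b < 1 := by
    have hbtc : b = t * c := by rw [htbc]; field_simp
    rw [hbtc, map_mul]
    calc V.valuation t * V.valuation c ≤ V.valuation t * 1 :=
          mul_le_mul_right ((ValuationSubring.valuation_le_one_iff V c).mpr (hBV hc)) _
      _ < 1 := by rw [mul_one]; exact hvt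
  -- `b = a'/x^m` with `a' ∈ 𝔪^m`; `v(b) < 1` forces `a' ∈ 𝔪^(m+1)`, so `v_W(b) < 1`
  obtain ⟨m, a', ha'm, hba'⟩ :=
    SwitchingDichotomy.QuadraticStep.exists_eq_div_pow_of_mem_blowupRing hxS hxK hb
  have ha'S : (⟨(a' : K), a'.2⟩ : ↥S) ∈ maximalIdeal ↥S ^ m := ha'm
  have ha'succ : (⟨(a' : K), a'.2⟩ : ↥S) ∈ maximalIdeal ↥S ^ (m + 1) := by
    refine (valuation_div_pow_lt_one_iff V hV hx hx2 ha'S).mp ?_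
    have : ((⟨(a' : K), a'.2⟩ : ↥S) : K) / (x : K) ^ m = b := by rw [hba']
    rw [this]
    exact hvb
  have hmemW : (a' : K) / (x : K) ^ (m + 1) ∈ W :=
    hBW (div_pow_mem_blowupRing (x : K) (m + 1) (f := (⟨(a' : K), a'.2⟩ : ↥S.toSubring)) ha'succ)
  have hb' : b = (x : K) * ((a' : K) / (x : K) ^ (m + 1)) := by
    rw [hba', pow_succ]
    field_simp
  have hwb : W.valuation b < 1 := by
    rw [hb', map_mul]
    calc W.valuation (x : K) * W.valuation ((a' : K) / (x : K) ^ (m + 1))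
        ≤ W.valuation (x : K) * 1 :=
          mul_le_mul_right ((ValuationSubring.valuation_le_one_iff W _).mpr hmemW) _
      _ < 1 := by rw [mul_one]; exact hxW
  -- contradiction: `v_W(t) = v_W(b) < 1`
  have hlt : W.valuation t < 1 := by
    rw [htbc, map_div₀, hwc, div_one]; exact hwb
  rw [hwt] at hlt
  exact lt_irrefl _ hlt

end CentreTransfer


/-! ## Zariski: an essentially finite prime divisor of a regular surface point `R` is `E_q` -/

section PrimeDivisor

variable {R : Subalgebra k K} [IsRegularLocalRing ↥R]

/-- **Zariski's theorem on prime divisors, in the line's vocabulary.**  Let `R` be a regular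
two-dimensional local `k`-subalgebra of `K` with `Frac R = K`, `tr.deg_k K = 2`, and let `W` be a
discrete valuation ring of `K` dominating `R` which is essentially of finite type over `R`
(`W = N_{𝔪_W ∩ N}` for a subring `N` finitely generated over `R` — the hypothesis shape of the tree's
`dvrReach`).  Then `W` is the ORDER VALUATION RING of an infinitely near point: there is a regular
two-dimensional local `k`-subalgebra `S ⊇ R` of `K`, dominated by `W`, with `↑W = ordSet S` — the
member of the quadratic sequence of `R` along `W` just before the sequence reaches `W`
(`RuledResidues….dvrReach`, `….penultimate`), identified with `E_S` by the chart characterization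
`coe_eq_ordSet_of_chart_le` and the centre transfer `mem_pow_succ_of_valuation_div_pow_lt_one`.
This is the bridge «exceptional prime divisor ⇒ base point» for the provers of S2 and S4.
[cite: ZariskiSamuel1960, App. 5] -/
theorem exists_coe_eq_ordSet_of_isDiscreteValuationRing [IsFractionRing ↥R K] (htr : Algebra.trdeg k K = 2)
    (hdimR : ringKrullDim ↥R = 2) (W : ValuationSubring K) [IsDiscreteValuationRing ↥W]
    (hRW : R.toSubring ≤ W.toSubring) (hdom : ∀ r : K, r ∈ R → r⁻¹ ∈ W → r⁻¹ ∈ R)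
    (N : Subring K) (hNW : N ≤ W.toSubring) (g : Finset K) (hgN : (g : Set K) ⊆ N)
    (hNg : N ≤ Subring.closure ((R : Set K) ∪ (g : Set K)))
    (hWN : W.toSubring ≤ locAtCentre N W) :
    ∃ S : Subalgebra k K, R ≤ S ∧ IsRegularLocalRing ↥S ∧ ringKrullDim ↥S = 2 ∧
      S.toSubring ≤ W.toSubring ∧ (∀ s : K, s ∈ S → s⁻¹ ∈ W → s⁻¹ ∈ S) ∧
      (W : Set K) = ordSet S := by
  classical
  haveI := isDomain_of_isRegularLocalRing (↥R)
  -- the quadratic sequence of `R` along `W` (Subring side)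
  set seq : ℕ → Subring K := quadraticSeq W R.toSubring with hseq
  have hseq0 : seq 0 = R.toSubring := rfl
  have hreg0 : IsRegularLocalRing ↥(seq 0) := ‹IsRegularLocalRing ↥R›
  haveI : IsLocalRing ↥(seq 0) := hreg0.toIsLocalRing
  have hof : IsLocalRingOf (seq 0) := by
    refine ⟨inferInstance, fun z => ?_⟩
    obtain ⟨a, b, hb, rfl⟩ := IsFractionRing.div_surjective (A := ↥R) z
    have hbK : (b : K) ≠ 0 := fun h => nonZeroDivisors.ne_zero hb (by exact_mod_cast h)
    exact ⟨(a : K), a.2, (b : K), b.2, hbK, rfl⟩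
  have h0 : SubringDominates (seq 0) W.toSubring := ⟨hRW, fun r hr hinv => hdom r hr hinv⟩
  have hnf : ¬ IsField ↥(seq 0) := fun hF => by
    have h := ringKrullDim_eq_zero_of_isField hF
    have h' : ringKrullDim ↥R = 0 := h
    rw [hdimR] at h'
    exact absurd h' (by norm_num)
  have hstep : ∀ i, IsQuadraticTransformAlong W (seq i) (seq (i + 1)) := fun i =>
    RuledResiduesRegularModelRuled.isQuadraticTransformAlong_quadraticSeq_of_isRegularLocalRing
      hreg0 hnf h0 i
  -- the sequence reaches `W`; the member before is regular of dimension `≥ 2`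
  obtain ⟨c, hc⟩ := RuledResiduesRegularModelRuled.dvrReach W seq hof h0 hstep hNW g hgN hNg hWN
  have h2 : (2 : WithBot ℕ∞) ≤ ringKrullDim ↥(seq 0) := by
    have : ringKrullDim ↥(seq 0) = ringKrullDim ↥R := rfl
    rw [this, hdimR]
  obtain ⟨n, hregn, hdimn, hsucc⟩ :=
    RuledResiduesRegularModelRuled.penultimate W seq hreg0 h2 hof h0 hstep ⟨c, hc⟩
  have hstepn : IsQuadraticTransformAlong W (seq n) W.toSubring := hsucc ▸ hstep n
  obtain ⟨hlocn, x, hx𝔪, hx0, hxmin, hWeq⟩ := hstepn.exists_eq_locAtCentre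
  have hdomn : SubringDominates (seq n) W.toSubring := (sequence_dominates h0 hstep n).1
  have hRn : R.toSubring ≤ seq n := sequence_monotone hstep (Nat.zero_le n)
  -- the `k`-subalgebra structure on `seq n`
  let S : Subalgebra k K :=
    { (seq n).toSubsemiring with
      algebraMap_mem' := fun c' => hRn (R.algebraMap_mem c') }
  have hSn : S.toSubring = seq n := rfl
  have hRS : R ≤ S := fun z hz => hRn hz
  have hregS : IsRegularLocalRing ↥S := hregn
  haveI := hregS
  haveI : IsFractionRing ↥S K := isFractionRing_subalgebra_of_le R S hRS
  -- dimension two: `≥ 2` from the penultimate ring, `≤ 2` from `tr.deg_k K = 2`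
  have hdimS : ringKrullDim ↥S = 2 := by
    refine le_antisymm ?_ hdimn
    have htrS : Algebra.trdeg k ↥S ≤ Algebra.trdeg k K :=
      trdeg_le_of_injective S.val Subtype.val_injective
    rw [htr] at htrS
    have h := ringKrullDim_le_of_trdeg_le (k := k) (R := ↥S) (n := 2) (by exact_mod_cast htrS)
    exact_mod_cast h
  -- the parameter `x`: positive `W`-value, not in `𝔪_S²`
  let xS : ↥S := ⟨(x : K), x.2⟩
  have hxK : (x : K) ≠ 0 := fun h => hx0 (Subtype.ext h)
  have hxS𝔪 : xS ∈ maximalIdeal ↥S := hx𝔪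
  have hxW : W.valuation (x : K) < 1 :=
    valuation_lt_one_of_subringDominates hdomn x.2 fun hinv =>
      ((mem_maximalIdeal_iff_inv_not_mem x).mp hx𝔪).elim (fun h => hxK h) (fun h => h hinv)
  have hw0 : 0 < W.valuation (x : K) := (Valuation.pos_iff _).mpr hxK
  have hxS2 : xS ∉ maximalIdeal ↥S ^ 2 := by
    intro hmem
    have key : ∀ r : ↥S, r ∈ maximalIdeal ↥S ^ 2 →
        W.valuation (r : K) ≤ W.valuation (x : K) * W.valuation (x : K) := by
      intro r hr
      rw [pow_two] at hr
      refine Submodule.mul_induction_on hr ?_ ?_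
      · intro m hm m' hm'
        rw [Subalgebra.coe_mul, map_mul]
        exact mul_le_mul' (hxmin _ hm) (hxmin _ hm')
      · intro r₁ r₂ h₁ h₂
        rw [Subalgebra.coe_add]
        exact (Valuation.map_add _ _ _).trans (max_le h₁ h₂)
    have h1 := key xS hmem
    have h3 : W.valuation (x : K) * W.valuation (x : K) < W.valuation (x : K) :=
      mul_lt_of_lt_one_left hw0 hxW
    exact lt_irrefl _ (h1.trans_lt h3)
  -- the chart lies in `W`, and `W` is the localisation of the chart at its centre
  have hBW' : blowupRing (seq n) (x : K) ≤ W.toSubring :=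
    (le_locAtCentre (blowupRing (seq n) (x : K)) W).trans hWeq.ge
  have hBW : blowupRing S.toSubring (x : K) ≤ W.toSubring := hBW'
  have hWB : W.toSubring ≤ locAtCentre (blowupRing S.toSubring (x : K)) W := hWeq.le
  have hchart : ∀ y : ↥S, y ∈ maximalIdeal ↥S → (y : K) / (x : K) ∈ W := fun y hy =>
    hBW (div_mem_blowupRing (x : K) (y := (⟨(y : K), y.2⟩ : ↥S.toSubring)) hy)
  have hcen := mem_pow_succ_of_valuation_div_pow_lt_one (S := S) W hxS𝔪 hxS2 hxW hBW hWB
  have hWtop : W ≠ ⊤ := by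
    intro h
    have hinv : ((x : K))⁻¹ ∈ W := by rw [h]; exact ValuationSubring.mem_top _
    have h1 := SyzygyFlattening.valuation_eq_one_of_inv_mem W (hdomn.1 x.2) hinv hxK
    exact absurd h1 hxW.ne
  have hSW : S.toSubring ≤ W.toSubring := by rw [hSn]; exact hdomn.1
  have hWS : (W : Set K) = ordSet S :=
    coe_eq_ordSet_of_chart_le W hWtop hSW hxS𝔪 hxS2 hchart hcen
  exact ⟨S, hRS, hregS, hdimS, hSW, fun s hs hinv => hdomn.2 s hs hinv, hWS⟩

end PrimeDivisor

end Summit.ResolutionOfSingularities.ResolutionOfSingularities.Theorems.NoZeno.SandwichCluster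

end
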